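import Summits.PneNP.PneNP.Theorems.ChebyshevTracialDesignStretchedExpAssembly
import HarnessLib

/-!
# Route `ChebyshevTracialDesign`, item `Assembly2`: the exp-normalised assembly

The support item `Summit.PneNP.PneNP.Theses.ChebyshevTracialDesign.Assembly2` says
`PsdHyperplaneBound → TracialDecayExp20 → ChebyshevDesign20 → Target`. Proof (the planner's
PLAN-Assembly2-ExpAssembly.md; the exp skeleton of `StretchedExpAssembly_proof`, p410145):

1. destructure the loss exponent `p` of the hyperplane bound, the decay rate `a` and threshold of
   `TracialDecayExp20`, and, for every large even `n`, the balanced exact design `(t, C, w)` of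
   `ChebyshevDesign20`;
2. Rothvoß's double count [Rothvoß 2017, §2 eq. (2)] gives `⟨W, S⟩ = Σ_c w_c (c - 1) = 1` for the design
   weight `W = levelWeight n t C w` and the odd-cut slack `S` (`sum_levelWeight_mul_slack`, p410145);
3. a psd factorization of `S` of size `r = 0` forces `S = 0`; for `r ≥ 1` with `r < exp(c·n^{1/4})`,
   `c = a/(4(p+2))`: `r²·n < exp(a·dq n)` (since `dq n > n^{1/4} - 1` and `log n ≤ 8 n^{1/8}`), so the
   decay hypothesis bounds the tracial value of `W` in dimension `r` by `exp(-a·dq n)`, and the hyperplane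
   bound with `Δ = n²` gives `1 = ⟨W,S⟩ ≤ r^p·n²·exp(-a·dq n) < 1` — contradiction (`key_arith_exp`).

Witnesses: `δ = 1/4`, `c = a/(4(p+2))`, `n₀ = max n₁ (max n₃ (max 256 ⌈(32/a)⁸⌉))`.
Nothing beyond the route's own hypotheses is assumed.
-/

set_option linter.dupNamespace false -- `Summit.PneNP.PneNP.…`: summit = sub-problem (D-0017)

noncomputable section

open Finset Real
open Literature.Combinatorics.Optimization Literature.Barriers.PneNP

namespace Summit.PneNP.PneNP.Theorems

namespace ChebyshevTracialDesignAssembly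

/-- `x ≤ n^{1/8}` from `x⁸ ≤ n` (`x ≥ 0`). [cite: CoppersmithRivlin1992, Thm. (p. 970); elementary] -/
theorem le_rpow_eighth {x : ℝ} (hx : 0 ≤ x) {n : ℕ} (h : x ^ 8 ≤ (n : ℝ)) :
    x ≤ (n : ℝ) ^ (1 / 8 : ℝ) := by
  calc x = (x ^ 8) ^ (1 / 8 : ℝ) := by
        rw [show (1 / 8 : ℝ) = ((8 : ℕ) : ℝ)⁻¹ by norm_num]
        exact (pow_rpow_inv_natCast hx (by norm_num)).symm
    _ ≤ (n : ℝ) ^ (1 / 8 : ℝ) := rpow_le_rpow (by positivity) h (by norm_num)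

/-- `(n^{1/8})² = n^{1/4}`. [cite: CoppersmithRivlin1992, Thm. (p. 970); elementary] -/
theorem rpow_eighth_sq (n : ℕ) : ((n : ℝ) ^ (1 / 8 : ℝ)) ^ 2 = (n : ℝ) ^ (1 / 4 : ℝ) := by
  rw [← rpow_mul_natCast (Nat.cast_nonneg n)]
  norm_num

/-- **The arithmetic of the exp-normalised assembly**: for `lr = log r ≥ 0`, `lr < a/(4(p+2)) · s²`
(`s = n^{1/8} ≥ max(2, 32/a)`), `s² - 1 < D` and `L = log n ≤ 8 s`: both `2·lr + L < a·D`
(the dimension budget `r²·n < exp(a·D)`) and `p·lr + 2L < a·D` (`r^p·n²·exp(-a·D) < 1`).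
[cite: Rothvoss2017, §2 (PDF pp. 6–8); elementary] -/
theorem key_arith_exp {a s D L lr : ℝ} {p : ℕ} (ha : 0 < a) (hs2 : 2 ≤ s) (hs : 32 / a ≤ s)
    (hD : s ^ 2 - 1 < D) (hL : L ≤ 8 * s) (hlr0 : 0 ≤ lr)
    (hlr : lr < a / (4 * ((p : ℝ) + 2)) * s ^ 2) :
    2 * lr + L < a * D ∧ (p : ℝ) * lr + 2 * L < a * D := by
  have hp0 : (0 : ℝ) ≤ p := Nat.cast_nonneg p
  have hs0 : 0 < s := lt_of_lt_of_le (by norm_num) hs2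
  have has : 32 ≤ a * s := by
    have := mul_le_mul_of_nonneg_left hs ha.le
    rwa [mul_div_cancel₀ _ ha.ne'] at this
  -- `(p + 2) · lr < a s² / 4`
  have h1 : ((p : ℝ) + 2) * lr < a * s ^ 2 / 4 := by
    have := mul_lt_mul_of_pos_left hlr (by positivity : (0 : ℝ) < (p : ℝ) + 2)
    calc ((p : ℝ) + 2) * lr < ((p : ℝ) + 2) * (a / (4 * ((p : ℝ) + 2)) * s ^ 2) := this
      _ = a * s ^ 2 / 4 := by field_simp
  have h2 : 2 * lr ≤ ((p : ℝ) + 2) * lr := by nlinarith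
  have h3 : (p : ℝ) * lr ≤ ((p : ℝ) + 2) * lr := by nlinarith
  -- `16 s ≤ a s² / 2` from `a s ≥ 32`, and `a ≤ a s² / 4` from `s ≥ 2`
  have h4 : 16 * s ≤ a * s ^ 2 / 2 := by nlinarith
  have h5 : a ≤ a * s ^ 2 / 4 := by nlinarith
  have h6 : a * s ^ 2 - a < a * D := by nlinarith
  constructor <;> nlinarith

end ChebyshevTracialDesignAssembly

open ChebyshevTracialDesignAssembly
open Summit.PneNP.PneNP.Theses.ChebyshevTracialDesign

/-- **Item `Assembly2` of route `ChebyshevTracialDesign`** (the exp-normalised assembly): the tracial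
hyperplane bound, the exp-normalised dimension-restricted tracial decay of balanced Chebyshev designs
(`TracialDecayExp20`) and the design existence (`ChebyshevDesign20`) give the rung leaf `Target`
(= `MatchingPsdRankStretchedExp`): no psd factorization of the odd-cut slack matrix of `P_PM(K_n)` of size
`r < exp(c·n^{1/4})`, with `c = a/(4(p+2))`. [cite: Rothvoss2017, §2 (PDF pp. 6–8)] -/
theorem Assembly2_proof :
    Summit.PneNP.PneNP.Theses.ChebyshevTracialDesign.Assembly2 := by
  intro hT hE h3
  obtain ⟨p, hp⟩ := hT
  obtain ⟨a, ha, n₁, hdec⟩ := hE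
  obtain ⟨n₃, hdes⟩ := h3
  refine ⟨1 / 4, by norm_num, a / (4 * ((p : ℝ) + 2)), by positivity,
    max n₁ (max n₃ (max 256 ⌈(32 / a) ^ 8⌉₊)), fun n hn hev r hr hfac => ?_⟩
  have hn₁ : n₁ ≤ n := le_trans (le_max_left _ _) hn
  have hn₃ : n₃ ≤ n := le_trans (le_max_left _ _) (le_trans (le_max_right _ _) hn)
  have hn256 : 256 ≤ n :=
    le_trans (le_max_left _ _) (le_trans (le_max_right _ _) (le_trans (le_max_right _ _) hn))
  have hnceil : ⌈(32 / a) ^ 8⌉₊ ≤ n :=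
    le_trans (le_max_right _ _) (le_trans (le_max_right _ _) (le_trans (le_max_right _ _) hn))
  have hnpos : (0 : ℝ) < n := by exact_mod_cast (by omega : 0 < n)
  obtain ⟨t, C, w, hbal⟩ := hdes n hn₃ hev
  have hne : ∀ c ∈ C, (Qset n t c).Nonempty := fun c hc => (hbal.1.2.2.2.1 c hc).2.2.2
  have hnorm : ∑ c ∈ C, w c * ((c : ℝ) - 1) = 1 := hbal.1.2.2.2.2.1
  -- the double count
  have hdc : ∑ U, ∑ M, levelWeight n t C w U M * pmOddCutSlack n U M = 1 := by
    rw [sum_levelWeight_mul_slack hne, hnorm]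
  rcases Nat.eq_zero_or_pos r with rfl | hr0
  · -- `r = 0`: the slack matrix would vanish
    obtain ⟨A, B, -, -, hS⟩ := hfac
    have h0 : ∀ U M, pmOddCutSlack n U M = 0 := fun U M => by
      rw [hS U M]; simp [Matrix.trace]
    simp only [h0, mul_zero, sum_const_zero] at hdc
    exact zero_ne_one hdc
  · -- `r ≥ 1`: hyperplane bound versus arithmetic
    set s : ℝ := (n : ℝ) ^ (1 / 8 : ℝ) with hs
    set D : ℝ := (dq n : ℝ) with hD
    set L : ℝ := Real.log n with hL
    have hsq : (n : ℝ) ^ (1 / 4 : ℝ) = s ^ 2 := by rw [hs, rpow_eighth_sq]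
    have hr0' : (0 : ℝ) < r := by exact_mod_cast hr0
    have hlr0 : 0 ≤ Real.log r := Real.log_nonneg (by exact_mod_cast hr0)
    have hlr : Real.log r < a / (4 * ((p : ℝ) + 2)) * s ^ 2 := by
      rw [← hsq]; exact (log_lt_iff_lt_exp hr0').2 hr
    have hs2 : 2 ≤ s := le_rpow_eighth (by norm_num) (by norm_num; exact_mod_cast hn256)
    have hs32 : 32 / a ≤ s :=
      le_rpow_eighth (by positivity) (le_trans (Nat.le_ceil _) (by exact_mod_cast hnceil))
    have hDq : s ^ 2 - 1 < D := by
      have := rpow_quarter_lt_dq_succ n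
      rw [hsq, ← hD] at this
      linarith
    have hL8 : L ≤ 8 * s := by
      have := Real.log_le_rpow_div hnpos.le (by norm_num : (0 : ℝ) < 1 / 8)
      rw [← hs, ← hL] at this
      linarith
    obtain ⟨hA1, hA2⟩ := key_arith_exp (p := p) ha hs2 hs32 hDq hL8 hlr0 hlr
    -- (1) `r² n < exp(a D)`: the dimension restriction
    have h1 : (r : ℝ) ^ 2 * n < Real.exp (a * (dq n : ℝ)) := by
      rw [← Real.log_lt_iff_lt_exp (by positivity), Real.log_mul (by positivity) hnpos.ne',
        Real.log_pow, Nat.cast_ofNat]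
      rw [← hD, ← hL]; linarith
    have hW := hdec n hn₁ hev t C w hbal r hr0 h1
    -- the hyperplane bound with `Δ = n²`
    have hbound := hp n r (pmOddCutSlack n) (levelWeight n t C w) ((n : ℝ) ^ 2)
      (Real.exp (-(a * (dq n : ℝ)))) (by positivity) (fun U M => cc_sub_one_le U M)
      (fun U M h1' => by simp [pmOddCutSlack, h1']) hW hfac
    rw [hdc] at hbound
    -- (2) `r^p n² exp(-a D) < 1`
    have h2 : (r : ℝ) ^ p * (n : ℝ) ^ 2 < Real.exp (a * (dq n : ℝ)) := by
      rw [← Real.log_lt_iff_lt_exp (by positivity), Real.log_mul (by positivity) (by positivity),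
        Real.log_pow, Real.log_pow, Nat.cast_ofNat]
      rw [← hD, ← hL]; linarith
    have h3' : (r : ℝ) ^ p * (n : ℝ) ^ 2 * Real.exp (-(a * (dq n : ℝ))) < 1 := by
      rw [Real.exp_neg, ← div_eq_mul_inv, div_lt_one (Real.exp_pos _)]
      exact h2
    linarith

end Summit.PneNP.PneNP.Theorems
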